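import Summits.Ventures.PercRepro.Lemma6

/-!
# PercRepro — the merge kernel: `Q⁺(Δ_g, Δ_g)` as a two-copy sum of merge vectors (typer-2, gen 3)

`LEAD-C011-concavity.md` §1–§2, the probability / algebra half of the type identity, part 1:

* `mergeVecM g m ω` — `e_{row(ω[g:=1])} − e_{row(ω[g:=0])}` on the 15 rows;
  `law4_update_sub_eq_sum` — `Δ_g = Σ_ω w_{p[g:=0]}(ω) · mergeVecM ω`;
* `kplus` — the integer kernel of `2·Q⁺` on the basis rows; `quadPlus_eq_kplus`;
  `quadPlus_sum_sum` (bilinearity); **`deltaQuad_eq_sum_sum`** —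
  `Q⁺(Δ_g, Δ_g) = Σ_{ω,ω′} w(ω) w(ω′) Q⁺(mergeVecM ω, mergeVecM ω′)`;
* the coarse kernel: `coarseOf` (nine coarse cells `⊤, x_i, R_i, ⊥, 3|1`), `kcoarse`,
  `coarseVec`, `coarseForm`, `quadPlus_eq_coarseForm`, `cVec`, `coarseVec_sub_rowVec`.
The coarse type vectors and the §2 sign table are `CoarseTypes.lean`.
-/

namespace PercRepro

open Finset

/-! ### The merge vector of a configuration -/

namespace MultiGraph

variable {V E : Type*} (G : MultiGraph V E) [Fintype E] [DecidableEq E]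

/-- The MERGE VECTOR of `ω` along `g`: `[row(ω[g := 1]) = s] − [row(ω[g := 0]) = s]` on the 15
rows of the marked partition of `m`. -/
noncomputable def mergeVecM (g : E) (m : Fin 4 → V) (ω : Config E) : Fin 15 → ℝ := fun s =>
  (if row4 (G.markedPartition (Function.update ω g true) m) = s then 1 else 0) -
    (if row4 (G.markedPartition (Function.update ω g false) m) = s then 1 else 0)

end MultiGraph

/-! ### Transport under `p[g := 0]` -/

section Transport

variable {E : Type*} [Fintype E] [DecidableEq E]

/-- Under `p[g := 0]` an event may be replaced by its pull-back along `ω ↦ ω[g := false]`. -/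
theorem prob_update_zero_eq_preimage_false (p : E → ℝ) (g : E) (A : Set (Config E)) :
    prob (Function.update p g 0) A =
      prob (Function.update p g 0) ((fun ω => Function.update ω g false) ⁻¹' A) := by
  refine prob_congr_of_support _ fun ω hw => ?_
  have h0 : ω g = false :=
    eq_false_of_weight_ne_zero_of_eq_zero hw (Function.update_self g 0 p)
  rw [Set.mem_preimage, show Function.update ω g false = ω from by
    funext e; by_cases he : e = g
    · subst he; simp [h0]
    · simp [Function.update_of_ne he]]

/-- Under `p[g := 1]` an event is the `p[g := 0]`-probability of its pull-back along
`ω ↦ ω[g := true]` (typer-1's flip transport, on the support `flipEdge g = update · g true`). -/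
theorem prob_update_one_eq_preimage_true (p : E → ℝ) (g : E) (A : Set (Config E)) :
    prob (Function.update p g 1) A =
      prob (Function.update p g 0) ((fun ω => Function.update ω g true) ⁻¹' A) := by
  rw [prob_update_one_eq_prob_update_zero_preimage]
  refine prob_congr_of_support _ fun ω hw => ?_
  have h0 : ω g = false :=
    eq_false_of_weight_ne_zero_of_eq_zero hw (Function.update_self g 0 p)
  simp only [Set.mem_preimage, flipEdge, h0, Bool.not_false]

end Transport

namespace MultiGraph

variable {V E : Type*} (G : MultiGraph V E) [Fintype E] [DecidableEq E]

/-- **`Δ_g` as a weighted sum of merge vectors**: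
`law4(p[g := 1]) s − law4(p[g := 0]) s = Σ_ω w_{p[g := 0]}(ω) · mergeVecM g m ω s`. -/
theorem law4_update_sub_eq_sum (p : E → ℝ) (g : E) (a b c d : V) (s : Fin 15) :
    G.law4 (Function.update p g 1) a b c d s - G.law4 (Function.update p g 0) a b c d s =
      ∑ ω : Config E, weight (Function.update p g 0) ω * G.mergeVecM g ![a, b, c, d] ω s := by
  classical
  simp only [law4]
  rw [prob_update_zero_eq_preimage_false p g (G.partitionEvent ![a, b, c, d] (rgs4 s)),
    prob_update_one_eq_preimage_true, prob, prob, ← Finset.sum_sub_distrib]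
  refine Finset.sum_congr rfl fun ω _ => ?_
  simp only [mergeVecM, Set.indicator_apply, Set.mem_preimage, mul_sub, mul_ite, mul_one, mul_zero]
  congr 1
  · by_cases h : Function.update ω g true ∈ G.partitionEvent ![a, b, c, d] (rgs4 s)
    · rw [if_pos h, if_pos ((G.row4_markedPartition_eq_iff _ _).mpr h)]
    · rw [if_neg h, if_neg (fun h' => h ((G.row4_markedPartition_eq_iff _ _).mp h'))]
  · by_cases h : Function.update ω g false ∈ G.partitionEvent ![a, b, c, d] (rgs4 s)
    · rw [if_pos h, if_pos ((G.row4_markedPartition_eq_iff _ _).mpr h)]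
    · rw [if_neg h, if_neg (fun h' => h ((G.row4_markedPartition_eq_iff _ _).mp h'))]

end MultiGraph

/-! ### The kernel of `Q⁺` -/

/-- The integer kernel of `2·Q⁺` on the basis rows (`kplus s t = 2·Q⁺(e_s, e_t)`): `+1` on
`(⊤, ⊥)`, `(⊥, ⊤)`; `−1` on `(x_i, x_j)`, `(x_i, R)`, `(R, x_i)` for `R ⋖ x_j`, `i ≠ j`. -/
def kplus : Fin 15 → Fin 15 → ℤ :=
  ![![0, 0, 0, 0, 0, 0, 0, 0, 0, 0, 0, 0, 0, 0, 1],
    ![0, 0, 0, 0, 0, 0, 0, 0, 0, 0, 0, 0, 0, 0, 0],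
    ![0, 0, 0, 0, 0, 0, 0, 0, 0, 0, 0, 0, 0, 0, 0],
    ![0, 0, 0, 0, 0, 0, -1, -1, -1, 0, -1, -1, -1, 0, 0],
    ![0, 0, 0, 0, 0, 0, -1, 0, -1, 0, 0, 0, 0, 0, 0],
    ![0, 0, 0, 0, 0, 0, 0, 0, 0, 0, 0, 0, 0, 0, 0],
    ![0, 0, 0, -1, -1, 0, 0, 0, -1, 0, -1, -1, 0, -1, 0],
    ![0, 0, 0, -1, 0, 0, 0, 0, -1, 0, 0, 0, 0, 0, 0],
    ![0, 0, 0, -1, -1, 0, -1, -1, 0, 0, 0, 0, -1, -1, 0],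
    ![0, 0, 0, 0, 0, 0, 0, 0, 0, 0, 0, 0, 0, 0, 0],
    ![0, 0, 0, -1, 0, 0, -1, 0, 0, 0, 0, 0, 0, 0, 0],
    ![0, 0, 0, -1, 0, 0, -1, 0, 0, 0, 0, 0, 0, 0, 0],
    ![0, 0, 0, -1, 0, 0, 0, 0, -1, 0, 0, 0, 0, 0, 0],
    ![0, 0, 0, 0, 0, 0, -1, 0, -1, 0, 0, 0, 0, 0, 0],
    ![1, 0, 0, 0, 0, 0, 0, 0, 0, 0, 0, 0, 0, 0, 0]]

/-- The kernel form of `Q⁺`: `Q⁺(u, v) = ½ Σ_{s,t} kplus s t · u s · v t`. -/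
theorem quadPlus_eq_kplus (u v : Fin 15 → ℝ) :
    quadPlus u v = (1 / 2 : ℝ) * ∑ s : Fin 15, ∑ t : Fin 15, (kplus s t : ℝ) * u s * v t := by
  simp only [quadPlus, crossOf, rank1Of, kplus, Fin.sum_univ_succ, Fin.sum_univ_zero]
  simp
  ring

/-- The kernel form is linear in its first argument over finite sums. -/
theorem kernelForm_sum_left {ι : Type*} (S : Finset ι) (c : ι → ℝ) (u : ι → Fin 15 → ℝ)
    (v : Fin 15 → ℝ) :
    ∑ s : Fin 15, ∑ t : Fin 15, (kplus s t : ℝ) * (∑ ω ∈ S, c ω * u ω s) * v t =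
      ∑ ω ∈ S, c ω * ∑ s : Fin 15, ∑ t : Fin 15, (kplus s t : ℝ) * u ω s * v t := by
  have step : ∀ s t : Fin 15, (kplus s t : ℝ) * (∑ ω ∈ S, c ω * u ω s) * v t =
      ∑ ω ∈ S, c ω * ((kplus s t : ℝ) * u ω s * v t) := by
    intro s t
    rw [Finset.mul_sum, Finset.sum_mul]
    exact Finset.sum_congr rfl fun ω _ => by ring
  simp only [step]
  calc ∑ s : Fin 15, ∑ t : Fin 15, ∑ ω ∈ S, c ω * ((kplus s t : ℝ) * u ω s * v t)
      = ∑ s : Fin 15, ∑ ω ∈ S, ∑ t : Fin 15, c ω * ((kplus s t : ℝ) * u ω s * v t) :=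
        Finset.sum_congr rfl fun s _ => Finset.sum_comm
    _ = ∑ ω ∈ S, ∑ s : Fin 15, ∑ t : Fin 15, c ω * ((kplus s t : ℝ) * u ω s * v t) :=
        Finset.sum_comm
    _ = ∑ ω ∈ S, c ω * ∑ s : Fin 15, ∑ t : Fin 15, (kplus s t : ℝ) * u ω s * v t := by
        simp only [Finset.mul_sum]

/-- The kernel form is linear in its second argument over finite sums. -/
theorem kernelForm_sum_right {ι : Type*} (S : Finset ι) (c : ι → ℝ) (u : Fin 15 → ℝ)
    (v : ι → Fin 15 → ℝ) :
    ∑ s : Fin 15, ∑ t : Fin 15, (kplus s t : ℝ) * u s * (∑ ω ∈ S, c ω * v ω t) =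
      ∑ ω ∈ S, c ω * ∑ s : Fin 15, ∑ t : Fin 15, (kplus s t : ℝ) * u s * v ω t := by
  have step : ∀ s t : Fin 15, (kplus s t : ℝ) * u s * (∑ ω ∈ S, c ω * v ω t) =
      ∑ ω ∈ S, c ω * ((kplus s t : ℝ) * u s * v ω t) := by
    intro s t
    rw [Finset.mul_sum]
    exact Finset.sum_congr rfl fun ω _ => by ring
  simp only [step]
  calc ∑ s : Fin 15, ∑ t : Fin 15, ∑ ω ∈ S, c ω * ((kplus s t : ℝ) * u s * v ω t)
      = ∑ s : Fin 15, ∑ ω ∈ S, ∑ t : Fin 15, c ω * ((kplus s t : ℝ) * u s * v ω t) :=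
        Finset.sum_congr rfl fun s _ => Finset.sum_comm
    _ = ∑ ω ∈ S, ∑ s : Fin 15, ∑ t : Fin 15, c ω * ((kplus s t : ℝ) * u s * v ω t) :=
        Finset.sum_comm
    _ = ∑ ω ∈ S, c ω * ∑ s : Fin 15, ∑ t : Fin 15, (kplus s t : ℝ) * u s * v ω t := by
        simp only [Finset.mul_sum]

/-- **`Q⁺` is bilinear over finite sums.** -/
theorem quadPlus_sum_sum {ι : Type*} (S : Finset ι) (c : ι → ℝ) (u : ι → Fin 15 → ℝ) :
    quadPlus (fun r => ∑ ω ∈ S, c ω * u ω r) (fun r => ∑ ω ∈ S, c ω * u ω r) =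
      ∑ ω ∈ S, ∑ ω' ∈ S, c ω * c ω' * quadPlus (u ω) (u ω') := by
  simp only [quadPlus_eq_kplus]
  rw [kernelForm_sum_left]
  simp only [kernelForm_sum_right]
  simp only [Finset.mul_sum]
  refine Finset.sum_congr rfl fun ω _ => Finset.sum_congr rfl fun ω' _ => ?_
  ring

namespace MultiGraph

variable {V E : Type*} (G : MultiGraph V E) [Fintype E] [DecidableEq E]

/-- **`Q⁺(Δ_g, Δ_g)` as a two-copy sum over the configurations of `G − g`**. -/
theorem deltaQuad_eq_sum_sum (p : E → ℝ) (g : E) (a b c d : V) :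
    G.deltaQuad p g a b c d =
      ∑ ω : Config E, ∑ ω' : Config E, weight (Function.update p g 0) ω *
        weight (Function.update p g 0) ω' *
          quadPlus (G.mergeVecM g ![a, b, c, d] ω) (G.mergeVecM g ![a, b, c, d] ω') := by
  unfold deltaQuad
  simp only [law4_update_sub_eq_sum]
  exact quadPlus_sum_sum Finset.univ (weight (Function.update p g 0)) (G.mergeVecM g ![a, b, c, d])

end MultiGraph

/-- The basis vector of a row. -/
def rowVec (s : Fin 15) : Fin 15 → ℝ := fun t => if s = t then 1 else 0

/-- `Q⁺` on differences of basis vectors, from the kernel: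
`2·Q⁺(e_{s′} − e_s, e_{t′} − e_t) = k(s′,t′) − k(s′,t) − k(s,t′) + k(s,t)`. -/
theorem quadPlus_basis (s s' t t' : Fin 15) :
    quadPlus (fun r => rowVec s' r - rowVec s r) (fun r => rowVec t' r - rowVec t r) =
      (1 / 2 : ℝ) * ((kplus s' t' : ℝ) - kplus s' t - kplus s t' + kplus s t) := by
  rw [quadPlus_eq_kplus]
  congr 1
  simp only [rowVec, mul_sub, Finset.sum_sub_distrib, mul_ite, mul_one, mul_zero,
    Finset.sum_ite_eq, Finset.mem_univ, if_true]
  ring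

/-! ### The coarse kernel: `Q⁺` only sees the nine coarse cells `⊤, x_i, R_i, ⊥, 3|1` -/

/-- The coarse cell of a row: `0 = ⊤`, `1, 2, 3 = x₀, x₁, x₂`, `4, 5, 6 = R₀, R₁, R₂` (the rank-1
mass below `x_i`), `7 = ⊥`, `8 = 3|1`. -/
def coarseOf : Fin 15 → Fin 9 := ![0, 8, 8, 1, 4, 8, 2, 5, 3, 8, 6, 6, 5, 4, 7]

/-- The kernel of `2·Q⁺` on the coarse cells. -/
def kcoarse : Fin 9 → Fin 9 → ℤ :=
  ![![0, 0, 0, 0, 0, 0, 0, 1, 0],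
    ![0, 0, -1, -1, 0, -1, -1, 0, 0],
    ![0, -1, 0, -1, -1, 0, -1, 0, 0],
    ![0, -1, -1, 0, -1, -1, 0, 0, 0],
    ![0, 0, -1, -1, 0, 0, 0, 0, 0],
    ![0, -1, 0, -1, 0, 0, 0, 0, 0],
    ![0, -1, -1, 0, 0, 0, 0, 0, 0],
    ![1, 0, 0, 0, 0, 0, 0, 0, 0],
    ![0, 0, 0, 0, 0, 0, 0, 0, 0]]

/-- `kplus` factors through the coarse cells. -/
theorem kplus_eq_kcoarse : ∀ s t : Fin 15, kplus s t = kcoarse (coarseOf s) (coarseOf t) := by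
  decide

/-- The coarse vector of a row vector (the masses of the nine coarse cells). -/
def coarseVec (u : Fin 15 → ℝ) : Fin 9 → ℝ := fun c => ∑ s : Fin 15, if coarseOf s = c then u s else 0

/-- `Q⁺` through the coarse cells: `Q⁺(u, v) = ½ Σ_{c,c′} kcoarse c c′ · ū_c · v̄_{c′}`. -/
theorem quadPlus_eq_coarse (u v : Fin 15 → ℝ) :
    quadPlus u v =
      (1 / 2 : ℝ) * ∑ c : Fin 9, ∑ c' : Fin 9, (kcoarse c c' : ℝ) * coarseVec u c * coarseVec v c' := by
  rw [quadPlus_eq_kplus]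
  congr 1
  simp only [coarseVec, kplus_eq_kcoarse, coarseOf, kcoarse, Fin.sum_univ_succ, Fin.sum_univ_zero]
  simp
  ring

/-- The coarse vector of a basis vector. -/
theorem coarseVec_rowVec (s : Fin 15) (c : Fin 9) :
    coarseVec (rowVec s) c = if coarseOf s = c then 1 else 0 := by
  simp only [coarseVec, rowVec]
  rw [Finset.sum_eq_single s]
  · simp
  · intro t _ hts
    simp [Ne.symm hts]
  · intro h
    exact absurd (Finset.mem_univ s) h

/-- The coarse kernel form. -/
noncomputable def coarseForm (x y : Fin 9 → ℝ) : ℝ :=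
  (1 / 2 : ℝ) * ∑ c : Fin 9, ∑ c' : Fin 9, (kcoarse c c' : ℝ) * x c * y c'

/-- `Q⁺` is the coarse form of the coarse vectors. -/
theorem quadPlus_eq_coarseForm (u v : Fin 15 → ℝ) :
    quadPlus u v = coarseForm (coarseVec u) (coarseVec v) :=
  quadPlus_eq_coarse u v

/-- The coarse basis vector. -/
def cVec (c : Fin 9) : Fin 9 → ℝ := fun c' => if c = c' then 1 else 0

/-- `coarseVec` is additive. -/
theorem coarseVec_sub (u v : Fin 15 → ℝ) :
    coarseVec (fun r => u r - v r) = fun c => coarseVec u c - coarseVec v c := by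
  funext c
  simp only [coarseVec]
  rw [← Finset.sum_sub_distrib]
  refine Finset.sum_congr rfl fun s _ => ?_
  split_ifs <;> simp

/-- The coarse vector of a merge vector `e_{s′} − e_s` is `cVec (coarseOf s′) − cVec (coarseOf s)`. -/
theorem coarseVec_sub_rowVec (s s' : Fin 15) :
    coarseVec (fun r => rowVec s' r - rowVec s r) =
      fun c => cVec (coarseOf s') c - cVec (coarseOf s) c := by
  rw [coarseVec_sub]
  funext c
  rw [coarseVec_rowVec, coarseVec_rowVec]
  rfl

end PercRepro
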